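import Summits.KontsevichZagierPeriods.KontsevichZagierPeriods.Theses.FermatIsogeny
import Literature.NumberTheory.Transcendental.GammaMonomialsProofs

/-!
# Linear targets of the linearisable exotic Γ-classes — KO certificates (decomp-kz · lens-5 · g20, menu (a))

Census g19/g20 (lens-5 node `SlackLinear.lean` §20–§22, `SlackAoki.lean` §23–§25): the exotic (Anderson–Das
2-torsion) Beta-PAIR sector of Conjecture 1 splits along the Γ-class in `tors(H_N/S_N) = ⊕ 𝔽₂·a_I`; the classes
with a ONE-LETTER representative are exactly `LIN = ⟨a_{2·3}, a_{2·5}, a_{2·7}, a_{3·5}, a_{3·7}, a_{3·11}(@66),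
a_{3·13}⟩ ≅ 𝔽₂⁷` (all `N ≤ 600`, and at every level modulo Aoki 1991 Thm 0.2 + the family lemma of §23), and
for such a class EVERY exotic pair follows from ONE linear identity of the class plus pointed `ϖ`-cancellation
(`Reblock.linear_bridge`, kernel-checked).  Three of the seven identities are in the tree (a_{2·3} = 13215 PROVED,
a_{3·5} = Das-15 pinned in 14858, a_{3·11} = InstanceSixtySix); this file lands the remaining FOUR as pinned
instances of `BetaLinearSector` (3897) with their Koblitz–Ogus certificates DISCHARGED:

* level 20, class `a_{2·5}`:  `B(1/20,2/20) = c₂₀·B(2/20,2/20)`, `c₂₀ = Γ(1/20)Γ(1/5)/(Γ(1/10)Γ(3/20))`;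
* level 28, class `a_{2·7}`:  `B(1/28,6/28) = c₂₈·B(2/28,3/28)`, `c₂₈ = Γ(1/28)Γ(5/28)Γ(3/14)/(Γ(1/14)Γ(3/28)Γ(1/4))`;
* level 21, class `a_{3·7}`:  `B(1/21,2/21) = c₂₁·B(2/21,2/21)`, `c₂₁ = Γ(1/21)Γ(4/21)/(Γ(2/21)Γ(1/7))`;
* level 39, class `a_{3·13}`: `B(4/39,10/39) = c₃₉·B(2/39,5/39)`, `c₃₉ = Γ(4/39)Γ(7/39)Γ(10/39)/(Γ(2/39)Γ(5/39)Γ(14/39))`.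

Per level: the multiplicity vector, its sum/product expansions, the Hodge-type test `IsHodgeTypeGammaMonomial N mult 0`
(a `decide` over `u mod N`, pattern `das_isHodgeType`), algebraicity of the constant from the tree's
`deligne_gammaMonomial_algebraic_holds`, the pinned Prop `LinN` and `BetaLinearSector → LinN`.
No `sorry`, no new axiom; imports: `Theses.FermatIsogeny`, `Literature…GammaMonomialsProofs`.
-/

namespace Summit.KontsevichZagierPeriods.FermatIsogeny.LinearTargets

open Literature.NumberTheory.Transcendental
open Summit.KontsevichZagierPeriods.KontsevichZagierPeriods.Theses.FermatIsogeny (BetaLinearSector)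

/-! ### Level 20: class `a_{2·5}` — `B(1/20,2/20) = c_20·B(2/20,2/20)`, `c_20 = 1.5104635576467…`,
common CM type `H = {1,3,11,13}` (census g19 T2 / g20). -/

/-- Multiplicity vector of the Γ-monomial `c_20 = B(1/20,2/20)/B(2/20,2/20)` on `{1/20,…,19/20}`. -/
def mult20 : ℕ → ℤ := fun i => if i = 1 then (1:ℤ) else if i = 4 then 1 else if i = 2 then -1 else if i = 3 then -1 else 0

/-- Expansion of a sum over `{1,…,19}` against `mult20`. [folklore] -/
theorem mult20_sum (F : ℕ → ℚ) :
    ∑ i ∈ Finset.Ico 1 20, ((mult20 i : ℤ) : ℚ) * F i = F 1 + F 4 - F 2 - F 3 := by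
  rw [Finset.sum_Ico_eq_sum_range]
  simp [Finset.sum_range_succ, mult20]
  ring

/-- Product form of `mult20_sum`. [folklore] -/
theorem mult20_prod (G : ℕ → ℂ) :
    ∏ i ∈ Finset.Ico 1 20, G i ^ (mult20 i) = G 1 * G 4 * (G 2)⁻¹ * (G 3)⁻¹ := by
  rw [Finset.prod_Ico_eq_prod_range]
  simp only [mult20, Finset.prod_range_succ, Finset.prod_range_zero, Nat.reduceSub, Nat.reduceAdd,
    Nat.reduceEqDiff, ↓reduceIte, zpow_zero, zpow_one, zpow_neg, one_mul, mul_one]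
  ring

/-- **KO certificate, level 20**: the Γ-monomial `mult20` has Hodge type with `c = 0` — a finite check on
`u mod 20` (equal CM types `H = {1,3,11,13}`). [this node] -/
theorem isHodgeType20 : IsHodgeTypeGammaMonomial 20 mult20 0 := by
  intro u hu
  rw [mult20_sum]
  have hf : ∀ i : ℕ, Int.fract ((u : ℚ) * (i : ℚ) / ((20 : ℕ) : ℚ)) =
      (((u * i) % 20 : ℕ) : ℚ) / ((20 : ℕ) : ℚ) := by
    intro i
    rw [show (u : ℚ) * (i : ℚ) / ((20 : ℕ) : ℚ) = ((u * i : ℕ) : ℚ) / ((20 : ℕ) : ℚ) by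
      push_cast; ring]
    exact Int.fract_div_natCast_eq_div_natCast_mod
  rw [hf 1, hf 4, hf 2, hf 3]
  have hr : u % 20 < 20 := Nat.mod_lt _ (by norm_num)
  have hg : Nat.gcd (u % 20) 20 = 1 := by
    rw [← Nat.gcd_rec]
    exact Nat.Coprime.gcd_eq_one hu.symm
  have key : ∀ r, r < 20 → Nat.gcd r 20 = 1 →
      (r * 1) % 20 + (r * 4) % 20 = (r * 2) % 20 + (r * 3) % 20 := by decide
  have hN := key (u % 20) hr hg
  have e : ∀ i : ℕ, (u * i) % 20 = (u % 20 * i) % 20 := fun i =>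
    ((Nat.mod_modEq u 20).mul_right i).symm
  rw [← e 1, ← e 4, ← e 2, ← e 3] at hN
  have hQ : ((u * 1 % 20 : ℕ) : ℚ) + ((u * 4 % 20 : ℕ) : ℚ) =
      ((u * 2 % 20 : ℕ) : ℚ) + ((u * 3 % 20 : ℕ) : ℚ) := by exact_mod_cast hN
  push_cast
  linear_combination (1/20 : ℚ) * hQ

/-- **The constant `c_20` is real algebraic** (Deligne–Koblitz–Ogus via the tree's
`deligne_gammaMonomial_algebraic_holds`, `d = 20`, `c = 0`). [this node] -/
theorem constant20_isAlgebraic :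
    IsAlgebraic ℚ (Real.Gamma (1/20) * Real.Gamma (1/5) * (Real.Gamma (1/10))⁻¹ * (Real.Gamma (3/20))⁻¹) := by
  have hKO := deligne_gammaMonomial_algebraic_holds 20 _ 0 (by norm_num) isHodgeType20
  unfold gammaTilde at hKO
  rw [mult20_prod, neg_zero, zpow_zero, one_mul] at hKO
  have hval : (Real.Gamma (((1 : ℕ) : ℝ) / (20 : ℕ)) : ℂ) *
      (Real.Gamma (((4 : ℕ) : ℝ) / (20 : ℕ)) : ℂ) *
      ((Real.Gamma (((2 : ℕ) : ℝ) / (20 : ℕ)) : ℂ))⁻¹ *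
      ((Real.Gamma (((3 : ℕ) : ℝ) / (20 : ℕ)) : ℂ))⁻¹ =
      algebraMap ℝ ℂ (Real.Gamma (1/20) * Real.Gamma (1/5) * (Real.Gamma (1/10))⁻¹ * (Real.Gamma (3/20))⁻¹) := by
    rw [Complex.coe_algebraMap]
    push_cast
    norm_num
  rw [hval, isAlgebraic_algebraMap_iff (RCLike.ofReal_injective (K := ℂ))] at hKO
  exact hKO

/-- **Pinned linear target, level 20** (class `a_{2·5}`): Conjecture 1 for the ONE pair
`B(1/20,2/20) = c_20·B(2/20,2/20)` — the instance of `BetaLinearSector` (3897) at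
`(a,b,a',b',c) = (1/20,2/20,2/20,2/20,c_20)`; the value hypothesis is kept verbatim (it HOLDS numerically:
`c_20 = 1.5104635576467`, census).  By §20 of the lens-5 node (`Reblock.linear_bridge`) this one identity + pointed
`ϖ`-cancellation decides EVERY exotic Beta pair of class `a_{2·5}` at every level. [this node] -/
def Lin20 : Prop :=
  ∀ (r r' : KZ.IntegralRep 1), r.domain = {x | x 0 ∈ Set.Ioo (0:ℝ) 1} →
    Set.EqOn r.integrand (fun x => (x 0) ^ (((1/20 : ℚ) : ℝ) - 1) * (1 - x 0) ^ (((2/20 : ℚ) : ℝ) - 1)) r.domain →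
    r'.domain = {x | x 0 ∈ Set.Ioo (0:ℝ) 1} →
    Set.EqOn r'.integrand (fun x => (Real.Gamma (1/20) * Real.Gamma (1/5) * (Real.Gamma (1/10))⁻¹ * (Real.Gamma (3/20))⁻¹) *
      (x 0) ^ (((2/20 : ℚ) : ℝ) - 1) * (1 - x 0) ^ (((2/20 : ℚ) : ℝ) - 1)) r'.domain →
    r.value = r'.value → KZ.Equivalent r r'

/-- `BetaLinearSector` (3897) ⟹ the pinned level-20 target. [this node] -/
theorem lin20_of_betaLinearSector (h : BetaLinearSector) : Lin20 :=
  fun r r' hd hi hd' hi' hv =>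
    h (1/20) (2/20) (2/20) (2/20) _ (by norm_num) (by norm_num) (by norm_num) (by norm_num)
      constant20_isAlgebraic r r' hd hi hd' hi' hv

/-! ### Level 28: class `a_{2·7}` — `B(1/28,6/28) = c_28·B(2/28,3/28)`, `c_28 = 1.4006473010235…`,
common CM type `H = {1,3,5,11,15,19}` (census g19 T2 / g20). -/

/-- Multiplicity vector of the Γ-monomial `c_28 = B(1/28,6/28)/B(2/28,3/28)` on `{1/28,…,27/28}`. -/
def mult28 : ℕ → ℤ := fun i => if i = 1 then (1:ℤ) else if i = 5 then 1 else if i = 6 then 1 else if i = 2 then -1 else if i = 3 then -1 else if i = 7 then -1 else 0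

/-- Expansion of a sum over `{1,…,27}` against `mult28`. [folklore] -/
theorem mult28_sum (F : ℕ → ℚ) :
    ∑ i ∈ Finset.Ico 1 28, ((mult28 i : ℤ) : ℚ) * F i = F 1 + F 5 + F 6 - F 2 - F 3 - F 7 := by
  rw [Finset.sum_Ico_eq_sum_range]
  simp [Finset.sum_range_succ, mult28]
  ring

/-- Product form of `mult28_sum`. [folklore] -/
theorem mult28_prod (G : ℕ → ℂ) :
    ∏ i ∈ Finset.Ico 1 28, G i ^ (mult28 i) = G 1 * G 5 * G 6 * (G 2)⁻¹ * (G 3)⁻¹ * (G 7)⁻¹ := by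
  rw [Finset.prod_Ico_eq_prod_range]
  simp only [mult28, Finset.prod_range_succ, Finset.prod_range_zero, Nat.reduceSub, Nat.reduceAdd,
    Nat.reduceEqDiff, ↓reduceIte, zpow_zero, zpow_one, zpow_neg, one_mul, mul_one]
  ring

/-- **KO certificate, level 28**: the Γ-monomial `mult28` has Hodge type with `c = 0` — a finite check on
`u mod 28` (equal CM types `H = {1,3,5,11,15,19}`). [this node] -/
theorem isHodgeType28 : IsHodgeTypeGammaMonomial 28 mult28 0 := by
  intro u hu
  rw [mult28_sum]
  have hf : ∀ i : ℕ, Int.fract ((u : ℚ) * (i : ℚ) / ((28 : ℕ) : ℚ)) =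
      (((u * i) % 28 : ℕ) : ℚ) / ((28 : ℕ) : ℚ) := by
    intro i
    rw [show (u : ℚ) * (i : ℚ) / ((28 : ℕ) : ℚ) = ((u * i : ℕ) : ℚ) / ((28 : ℕ) : ℚ) by
      push_cast; ring]
    exact Int.fract_div_natCast_eq_div_natCast_mod
  rw [hf 1, hf 5, hf 6, hf 2, hf 3, hf 7]
  have hr : u % 28 < 28 := Nat.mod_lt _ (by norm_num)
  have hg : Nat.gcd (u % 28) 28 = 1 := by
    rw [← Nat.gcd_rec]
    exact Nat.Coprime.gcd_eq_one hu.symm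
  have key : ∀ r, r < 28 → Nat.gcd r 28 = 1 →
      (r * 1) % 28 + (r * 5) % 28 + (r * 6) % 28 = (r * 2) % 28 + (r * 3) % 28 + (r * 7) % 28 := by decide
  have hN := key (u % 28) hr hg
  have e : ∀ i : ℕ, (u * i) % 28 = (u % 28 * i) % 28 := fun i =>
    ((Nat.mod_modEq u 28).mul_right i).symm
  rw [← e 1, ← e 5, ← e 6, ← e 2, ← e 3, ← e 7] at hN
  have hQ : ((u * 1 % 28 : ℕ) : ℚ) + ((u * 5 % 28 : ℕ) : ℚ) + ((u * 6 % 28 : ℕ) : ℚ) =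
      ((u * 2 % 28 : ℕ) : ℚ) + ((u * 3 % 28 : ℕ) : ℚ) + ((u * 7 % 28 : ℕ) : ℚ) := by exact_mod_cast hN
  push_cast
  linear_combination (1/28 : ℚ) * hQ

/-- **The constant `c_28` is real algebraic** (Deligne–Koblitz–Ogus via the tree's
`deligne_gammaMonomial_algebraic_holds`, `d = 28`, `c = 0`). [this node] -/
theorem constant28_isAlgebraic :
    IsAlgebraic ℚ (Real.Gamma (1/28) * Real.Gamma (5/28) * Real.Gamma (3/14) * (Real.Gamma (1/14))⁻¹ * (Real.Gamma (3/28))⁻¹ * (Real.Gamma (1/4))⁻¹) := by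
  have hKO := deligne_gammaMonomial_algebraic_holds 28 _ 0 (by norm_num) isHodgeType28
  unfold gammaTilde at hKO
  rw [mult28_prod, neg_zero, zpow_zero, one_mul] at hKO
  have hval : (Real.Gamma (((1 : ℕ) : ℝ) / (28 : ℕ)) : ℂ) *
      (Real.Gamma (((5 : ℕ) : ℝ) / (28 : ℕ)) : ℂ) *
      (Real.Gamma (((6 : ℕ) : ℝ) / (28 : ℕ)) : ℂ) *
      ((Real.Gamma (((2 : ℕ) : ℝ) / (28 : ℕ)) : ℂ))⁻¹ *
      ((Real.Gamma (((3 : ℕ) : ℝ) / (28 : ℕ)) : ℂ))⁻¹ *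
      ((Real.Gamma (((7 : ℕ) : ℝ) / (28 : ℕ)) : ℂ))⁻¹ =
      algebraMap ℝ ℂ (Real.Gamma (1/28) * Real.Gamma (5/28) * Real.Gamma (3/14) * (Real.Gamma (1/14))⁻¹ * (Real.Gamma (3/28))⁻¹ * (Real.Gamma (1/4))⁻¹) := by
    rw [Complex.coe_algebraMap]
    push_cast
    norm_num
  rw [hval, isAlgebraic_algebraMap_iff (RCLike.ofReal_injective (K := ℂ))] at hKO
  exact hKO

/-- **Pinned linear target, level 28** (class `a_{2·7}`): Conjecture 1 for the ONE pair
`B(1/28,6/28) = c_28·B(2/28,3/28)` — the instance of `BetaLinearSector` (3897) at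
`(a,b,a',b',c) = (1/28,6/28,2/28,3/28,c_28)`; the value hypothesis is kept verbatim (it HOLDS numerically:
`c_28 = 1.4006473010235`, census).  By §20 of the lens-5 node (`Reblock.linear_bridge`) this one identity + pointed
`ϖ`-cancellation decides EVERY exotic Beta pair of class `a_{2·7}` at every level. [this node] -/
def Lin28 : Prop :=
  ∀ (r r' : KZ.IntegralRep 1), r.domain = {x | x 0 ∈ Set.Ioo (0:ℝ) 1} →
    Set.EqOn r.integrand (fun x => (x 0) ^ (((1/28 : ℚ) : ℝ) - 1) * (1 - x 0) ^ (((6/28 : ℚ) : ℝ) - 1)) r.domain →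
    r'.domain = {x | x 0 ∈ Set.Ioo (0:ℝ) 1} →
    Set.EqOn r'.integrand (fun x => (Real.Gamma (1/28) * Real.Gamma (5/28) * Real.Gamma (3/14) * (Real.Gamma (1/14))⁻¹ * (Real.Gamma (3/28))⁻¹ * (Real.Gamma (1/4))⁻¹) *
      (x 0) ^ (((2/28 : ℚ) : ℝ) - 1) * (1 - x 0) ^ (((3/28 : ℚ) : ℝ) - 1)) r'.domain →
    r.value = r'.value → KZ.Equivalent r r'

/-- `BetaLinearSector` (3897) ⟹ the pinned level-28 target. [this node] -/
theorem lin28_of_betaLinearSector (h : BetaLinearSector) : Lin28 :=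
  fun r r' hd hi hd' hi' hv =>
    h (1/28) (6/28) (2/28) (3/28) _ (by norm_num) (by norm_num) (by norm_num) (by norm_num)
      constant28_isAlgebraic r r' hd hi hd' hi' hv

/-! ### Level 21: class `a_{3·7}` — `B(1/21,2/21) = c_21·B(2/21,2/21)`, `c_21 = 1.5095585319646…`,
common CM type `H = {1,2,4,5,11,13}` (census g19 T2 / g20). -/

/-- Multiplicity vector of the Γ-monomial `c_21 = B(1/21,2/21)/B(2/21,2/21)` on `{1/21,…,20/21}`. -/
def mult21 : ℕ → ℤ := fun i => if i = 1 then (1:ℤ) else if i = 4 then 1 else if i = 2 then -1 else if i = 3 then -1 else 0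

/-- Expansion of a sum over `{1,…,20}` against `mult21`. [folklore] -/
theorem mult21_sum (F : ℕ → ℚ) :
    ∑ i ∈ Finset.Ico 1 21, ((mult21 i : ℤ) : ℚ) * F i = F 1 + F 4 - F 2 - F 3 := by
  rw [Finset.sum_Ico_eq_sum_range]
  simp [Finset.sum_range_succ, mult21]
  ring

/-- Product form of `mult21_sum`. [folklore] -/
theorem mult21_prod (G : ℕ → ℂ) :
    ∏ i ∈ Finset.Ico 1 21, G i ^ (mult21 i) = G 1 * G 4 * (G 2)⁻¹ * (G 3)⁻¹ := by
  rw [Finset.prod_Ico_eq_prod_range]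
  simp only [mult21, Finset.prod_range_succ, Finset.prod_range_zero, Nat.reduceSub, Nat.reduceAdd,
    Nat.reduceEqDiff, ↓reduceIte, zpow_zero, zpow_one, zpow_neg, one_mul, mul_one]
  ring

/-- **KO certificate, level 21**: the Γ-monomial `mult21` has Hodge type with `c = 0` — a finite check on
`u mod 21` (equal CM types `H = {1,2,4,5,11,13}`). [this node] -/
theorem isHodgeType21 : IsHodgeTypeGammaMonomial 21 mult21 0 := by
  intro u hu
  rw [mult21_sum]
  have hf : ∀ i : ℕ, Int.fract ((u : ℚ) * (i : ℚ) / ((21 : ℕ) : ℚ)) =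
      (((u * i) % 21 : ℕ) : ℚ) / ((21 : ℕ) : ℚ) := by
    intro i
    rw [show (u : ℚ) * (i : ℚ) / ((21 : ℕ) : ℚ) = ((u * i : ℕ) : ℚ) / ((21 : ℕ) : ℚ) by
      push_cast; ring]
    exact Int.fract_div_natCast_eq_div_natCast_mod
  rw [hf 1, hf 4, hf 2, hf 3]
  have hr : u % 21 < 21 := Nat.mod_lt _ (by norm_num)
  have hg : Nat.gcd (u % 21) 21 = 1 := by
    rw [← Nat.gcd_rec]
    exact Nat.Coprime.gcd_eq_one hu.symm
  have key : ∀ r, r < 21 → Nat.gcd r 21 = 1 →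
      (r * 1) % 21 + (r * 4) % 21 = (r * 2) % 21 + (r * 3) % 21 := by decide
  have hN := key (u % 21) hr hg
  have e : ∀ i : ℕ, (u * i) % 21 = (u % 21 * i) % 21 := fun i =>
    ((Nat.mod_modEq u 21).mul_right i).symm
  rw [← e 1, ← e 4, ← e 2, ← e 3] at hN
  have hQ : ((u * 1 % 21 : ℕ) : ℚ) + ((u * 4 % 21 : ℕ) : ℚ) =
      ((u * 2 % 21 : ℕ) : ℚ) + ((u * 3 % 21 : ℕ) : ℚ) := by exact_mod_cast hN
  push_cast
  linear_combination (1/21 : ℚ) * hQ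

/-- **The constant `c_21` is real algebraic** (Deligne–Koblitz–Ogus via the tree's
`deligne_gammaMonomial_algebraic_holds`, `d = 21`, `c = 0`). [this node] -/
theorem constant21_isAlgebraic :
    IsAlgebraic ℚ (Real.Gamma (1/21) * Real.Gamma (4/21) * (Real.Gamma (2/21))⁻¹ * (Real.Gamma (1/7))⁻¹) := by
  have hKO := deligne_gammaMonomial_algebraic_holds 21 _ 0 (by norm_num) isHodgeType21
  unfold gammaTilde at hKO
  rw [mult21_prod, neg_zero, zpow_zero, one_mul] at hKO
  have hval : (Real.Gamma (((1 : ℕ) : ℝ) / (21 : ℕ)) : ℂ) *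
      (Real.Gamma (((4 : ℕ) : ℝ) / (21 : ℕ)) : ℂ) *
      ((Real.Gamma (((2 : ℕ) : ℝ) / (21 : ℕ)) : ℂ))⁻¹ *
      ((Real.Gamma (((3 : ℕ) : ℝ) / (21 : ℕ)) : ℂ))⁻¹ =
      algebraMap ℝ ℂ (Real.Gamma (1/21) * Real.Gamma (4/21) * (Real.Gamma (2/21))⁻¹ * (Real.Gamma (1/7))⁻¹) := by
    rw [Complex.coe_algebraMap]
    push_cast
    norm_num
  rw [hval, isAlgebraic_algebraMap_iff (RCLike.ofReal_injective (K := ℂ))] at hKO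
  exact hKO

/-- **Pinned linear target, level 21** (class `a_{3·7}`): Conjecture 1 for the ONE pair
`B(1/21,2/21) = c_21·B(2/21,2/21)` — the instance of `BetaLinearSector` (3897) at
`(a,b,a',b',c) = (1/21,2/21,2/21,2/21,c_21)`; the value hypothesis is kept verbatim (it HOLDS numerically:
`c_21 = 1.5095585319646`, census).  By §20 of the lens-5 node (`Reblock.linear_bridge`) this one identity + pointed
`ϖ`-cancellation decides EVERY exotic Beta pair of class `a_{3·7}` at every level. [this node] -/
def Lin21 : Prop :=
  ∀ (r r' : KZ.IntegralRep 1), r.domain = {x | x 0 ∈ Set.Ioo (0:ℝ) 1} →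
    Set.EqOn r.integrand (fun x => (x 0) ^ (((1/21 : ℚ) : ℝ) - 1) * (1 - x 0) ^ (((2/21 : ℚ) : ℝ) - 1)) r.domain →
    r'.domain = {x | x 0 ∈ Set.Ioo (0:ℝ) 1} →
    Set.EqOn r'.integrand (fun x => (Real.Gamma (1/21) * Real.Gamma (4/21) * (Real.Gamma (2/21))⁻¹ * (Real.Gamma (1/7))⁻¹) *
      (x 0) ^ (((2/21 : ℚ) : ℝ) - 1) * (1 - x 0) ^ (((2/21 : ℚ) : ℝ) - 1)) r'.domain →
    r.value = r'.value → KZ.Equivalent r r'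

/-- `BetaLinearSector` (3897) ⟹ the pinned level-21 target. [this node] -/
theorem lin21_of_betaLinearSector (h : BetaLinearSector) : Lin21 :=
  fun r r' hd hi hd' hi' hv =>
    h (1/21) (2/21) (2/21) (2/21) _ (by norm_num) (by norm_num) (by norm_num) (by norm_num)
      constant21_isAlgebraic r r' hd hi hd' hi' hv

/-! ### Level 39: class `a_{3·13}` — `B(4/39,10/39) = c_39·B(2/39,5/39)`, `c_39 = 0.4877210370247…`,
common CM type `H = {1,2,4,5,8,10,11,16,20,22,25,32} = ker χ₋₃₉` (census g19 T2 / g20). -/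

/-- Multiplicity vector of the Γ-monomial `c_39 = B(4/39,10/39)/B(2/39,5/39)` on `{1/39,…,38/39}`. -/
def mult39 : ℕ → ℤ := fun i => if i = 4 then (1:ℤ) else if i = 7 then 1 else if i = 10 then 1 else if i = 2 then -1 else if i = 5 then -1 else if i = 14 then -1 else 0

/-- Expansion of a sum over `{1,…,38}` against `mult39`. [folklore] -/
theorem mult39_sum (F : ℕ → ℚ) :
    ∑ i ∈ Finset.Ico 1 39, ((mult39 i : ℤ) : ℚ) * F i = F 4 + F 7 + F 10 - F 2 - F 5 - F 14 := by
  rw [Finset.sum_Ico_eq_sum_range]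
  simp [Finset.sum_range_succ, mult39]
  ring

/-- Product form of `mult39_sum`. [folklore] -/
theorem mult39_prod (G : ℕ → ℂ) :
    ∏ i ∈ Finset.Ico 1 39, G i ^ (mult39 i) = G 4 * G 7 * G 10 * (G 2)⁻¹ * (G 5)⁻¹ * (G 14)⁻¹ := by
  rw [Finset.prod_Ico_eq_prod_range]
  simp only [mult39, Finset.prod_range_succ, Finset.prod_range_zero, Nat.reduceSub, Nat.reduceAdd,
    Nat.reduceEqDiff, ↓reduceIte, zpow_zero, zpow_one, zpow_neg, one_mul, mul_one]
  ring

/-- **KO certificate, level 39**: the Γ-monomial `mult39` has Hodge type with `c = 0` — a finite check on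
`u mod 39` (equal CM types `H = {1,2,4,5,8,10,11,16,20,22,25,32} = ker χ₋₃₉`). [this node] -/
theorem isHodgeType39 : IsHodgeTypeGammaMonomial 39 mult39 0 := by
  intro u hu
  rw [mult39_sum]
  have hf : ∀ i : ℕ, Int.fract ((u : ℚ) * (i : ℚ) / ((39 : ℕ) : ℚ)) =
      (((u * i) % 39 : ℕ) : ℚ) / ((39 : ℕ) : ℚ) := by
    intro i
    rw [show (u : ℚ) * (i : ℚ) / ((39 : ℕ) : ℚ) = ((u * i : ℕ) : ℚ) / ((39 : ℕ) : ℚ) by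
      push_cast; ring]
    exact Int.fract_div_natCast_eq_div_natCast_mod
  rw [hf 4, hf 7, hf 10, hf 2, hf 5, hf 14]
  have hr : u % 39 < 39 := Nat.mod_lt _ (by norm_num)
  have hg : Nat.gcd (u % 39) 39 = 1 := by
    rw [← Nat.gcd_rec]
    exact Nat.Coprime.gcd_eq_one hu.symm
  have key : ∀ r, r < 39 → Nat.gcd r 39 = 1 →
      (r * 4) % 39 + (r * 7) % 39 + (r * 10) % 39 = (r * 2) % 39 + (r * 5) % 39 + (r * 14) % 39 := by decide
  have hN := key (u % 39) hr hg
  have e : ∀ i : ℕ, (u * i) % 39 = (u % 39 * i) % 39 := fun i =>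
    ((Nat.mod_modEq u 39).mul_right i).symm
  rw [← e 4, ← e 7, ← e 10, ← e 2, ← e 5, ← e 14] at hN
  have hQ : ((u * 4 % 39 : ℕ) : ℚ) + ((u * 7 % 39 : ℕ) : ℚ) + ((u * 10 % 39 : ℕ) : ℚ) =
      ((u * 2 % 39 : ℕ) : ℚ) + ((u * 5 % 39 : ℕ) : ℚ) + ((u * 14 % 39 : ℕ) : ℚ) := by exact_mod_cast hN
  push_cast
  linear_combination (1/39 : ℚ) * hQ

/-- **The constant `c_39` is real algebraic** (Deligne–Koblitz–Ogus via the tree's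
`deligne_gammaMonomial_algebraic_holds`, `d = 39`, `c = 0`). [this node] -/
theorem constant39_isAlgebraic :
    IsAlgebraic ℚ (Real.Gamma (4/39) * Real.Gamma (7/39) * Real.Gamma (10/39) * (Real.Gamma (2/39))⁻¹ * (Real.Gamma (5/39))⁻¹ * (Real.Gamma (14/39))⁻¹) := by
  have hKO := deligne_gammaMonomial_algebraic_holds 39 _ 0 (by norm_num) isHodgeType39
  unfold gammaTilde at hKO
  rw [mult39_prod, neg_zero, zpow_zero, one_mul] at hKO
  have hval : (Real.Gamma (((4 : ℕ) : ℝ) / (39 : ℕ)) : ℂ) *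
      (Real.Gamma (((7 : ℕ) : ℝ) / (39 : ℕ)) : ℂ) *
      (Real.Gamma (((10 : ℕ) : ℝ) / (39 : ℕ)) : ℂ) *
      ((Real.Gamma (((2 : ℕ) : ℝ) / (39 : ℕ)) : ℂ))⁻¹ *
      ((Real.Gamma (((5 : ℕ) : ℝ) / (39 : ℕ)) : ℂ))⁻¹ *
      ((Real.Gamma (((14 : ℕ) : ℝ) / (39 : ℕ)) : ℂ))⁻¹ =
      algebraMap ℝ ℂ (Real.Gamma (4/39) * Real.Gamma (7/39) * Real.Gamma (10/39) * (Real.Gamma (2/39))⁻¹ * (Real.Gamma (5/39))⁻¹ * (Real.Gamma (14/39))⁻¹) := by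
    rw [Complex.coe_algebraMap]
    push_cast
    norm_num
  rw [hval, isAlgebraic_algebraMap_iff (RCLike.ofReal_injective (K := ℂ))] at hKO
  exact hKO

/-- **Pinned linear target, level 39** (class `a_{3·13}`): Conjecture 1 for the ONE pair
`B(4/39,10/39) = c_39·B(2/39,5/39)` — the instance of `BetaLinearSector` (3897) at
`(a,b,a',b',c) = (4/39,10/39,2/39,5/39,c_39)`; the value hypothesis is kept verbatim (it HOLDS numerically:
`c_39 = 0.4877210370247`, census).  By §20 of the lens-5 node (`Reblock.linear_bridge`) this one identity + pointed
`ϖ`-cancellation decides EVERY exotic Beta pair of class `a_{3·13}` at every level. [this node] -/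
def Lin39 : Prop :=
  ∀ (r r' : KZ.IntegralRep 1), r.domain = {x | x 0 ∈ Set.Ioo (0:ℝ) 1} →
    Set.EqOn r.integrand (fun x => (x 0) ^ (((4/39 : ℚ) : ℝ) - 1) * (1 - x 0) ^ (((10/39 : ℚ) : ℝ) - 1)) r.domain →
    r'.domain = {x | x 0 ∈ Set.Ioo (0:ℝ) 1} →
    Set.EqOn r'.integrand (fun x => (Real.Gamma (4/39) * Real.Gamma (7/39) * Real.Gamma (10/39) * (Real.Gamma (2/39))⁻¹ * (Real.Gamma (5/39))⁻¹ * (Real.Gamma (14/39))⁻¹) *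
      (x 0) ^ (((2/39 : ℚ) : ℝ) - 1) * (1 - x 0) ^ (((5/39 : ℚ) : ℝ) - 1)) r'.domain →
    r.value = r'.value → KZ.Equivalent r r'

/-- `BetaLinearSector` (3897) ⟹ the pinned level-39 target. [this node] -/
theorem lin39_of_betaLinearSector (h : BetaLinearSector) : Lin39 :=
  fun r r' hd hi hd' hi' hv =>
    h (4/39) (10/39) (2/39) (5/39) _ (by norm_num) (by norm_num) (by norm_num) (by norm_num)
      constant39_isAlgebraic r r' hd hi hd' hi' hv

/-- The four new linear targets together. [this node] -/
theorem linearTargets_of_betaLinearSector (h : BetaLinearSector) : Lin20 ∧ Lin28 ∧ Lin21 ∧ Lin39 :=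
  ⟨lin20_of_betaLinearSector h, lin28_of_betaLinearSector h, lin21_of_betaLinearSector h,
    lin39_of_betaLinearSector h⟩

end Summit.KontsevichZagierPeriods.FermatIsogeny.LinearTargets
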